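import Summits.Ventures.PercRepro.RankLevelSetHallLostInj

/-!
# PercRepro — THE CYCLIC-PART REDUCTION OF THE LOST-SET INJECTION: `(INJ)` FOLLOWS FROM A LEVEL-MATCHING STATEMENT FOR
THE INDEPENDENT SETS OVER EACH CYCLIC SET (p4, gen 34; C-044, UP form at the tight layer; paper proofs/P4-CELL-THREE.md §14.22)

Write a lost set as `S = C ⊔ K` with `C = {x ∈ S | x ∈ cl(S ∖ x)}` its **cyclic part** (the non-coloops of `M|S`) and
`K = S ∖ C` its coloops.  Then `r(S) = r(C) + #K` (`eRk_eq_eRk_sdiff_add_ncard`), `K` lies outside `cl C`, and for a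
member `Z ⊆ S` the count `#(Z ∩ C) ≤ r(C)` forces `K ⊆ Z`, so that `E ∖ Z ⊆ cl C ∪ ((E ∖ cl C) ∖ K)` bounds the rank of
`C ∪ ((E ∖ cl C) ∖ K)` below by `p`.  The **max-rank targets** of `S` are the sets `C ∪ K'` with `K' ⊇ K` independent
over `cl C` of size `#K + (p − #S)`: `p`-sets of rank `q + (p − #S) ∈ (q, p)` whose cyclic part is again `C`.  Hence ANY
family of injections `ψ C i d` — one for each set `C`, level `i` and step `d` — from the independent `i`-sets `K` over
`cl C` whose complement has rank `≥ r(C) + i + d + 1` into the independent `(i + d)`-sets over `cl C` containing them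
gives `(INJ)`: `S ↦ C ∪ ψ C (#K) (p − #S) K` (**`lostInj_of_levelInj`**): the image determines `C` (its cyclic part),
then `#K` (`r(C) + #K = q`) and `p − #S`, and then `K` by the injectivity of `ψ C (#K) (p − #S)`.  The hypothesis is, in
the contraction `M / cl C`, «the independent `i`-sets `K` with `r(E ∖ K) ≥ i + d + 1` inject into the independent
`(i + d)`-sets» — Lemma L3′ of §14.22, true on every matroid with `≤ 9` elements; it is a HYPOTHESIS here, NOT asserted.
* `eRk_sdiff_union_finset`, `eRk_eq_eRk_sdiff_add_ncard` — `r(S) = r(S ∖ K) + #K` for a set `K` of coloops of `M|S`;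
* `eRk_sdiff_singleton_eq_of_mem_closure` — an element in the closure of the rest does not count for the rank;
* **`lostInj_of_levelInj`** — the reduction.
Axioms: standard.
-/

namespace PercRepro

open Set Matroid

variable {α : Type} (M : Matroid α) [M.Finite]

omit [M.Finite] in
/-- Adding elements of `K` — each outside the closure of `S` minus itself — to `S ∖ K` raises the rank by one each. -/
theorem eRk_sdiff_union_finset {S K : Set α} (hSE : S ⊆ M.E) (hKS : K ⊆ S)
    (hK : ∀ x ∈ K, x ∉ M.closure (S \ {x})) :
    ∀ F : Finset α, (↑F : Set α) ⊆ K → M.eRk ((S \ K) ∪ ↑F) = M.eRk (S \ K) + F.card := by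
  classical
  intro F
  induction F using Finset.induction_on with
  | empty => intro _; simp
  | @insert x F hxF ih =>
    intro hFK
    have hxK : x ∈ K := hFK (Finset.mem_insert_self x F)
    have hFK' : (↑F : Set α) ⊆ K := fun y hy => hFK (Finset.mem_insert_of_mem hy)
    have hsub : (S \ K) ∪ ↑F ⊆ S \ {x} := by
      intro y hy
      rcases hy with hy | hy
      · refine ⟨hy.1, fun h => hy.2 ?_⟩
        rw [mem_singleton_iff] at h
        rw [h]; exact hxK
      · refine ⟨hKS (hFK' hy), fun h => ?_⟩
        rw [mem_singleton_iff] at h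
        exact hxF (h ▸ hy)
    have hx : x ∈ M.E \ M.closure ((S \ K) ∪ ↑F) :=
      ⟨hSE (hKS hxK), fun h => hK x hxK (M.closure_subset_closure hsub h)⟩
    rw [Finset.coe_insert, union_insert, eRk_insert_eq_add_one hx, ih hFK', Finset.card_insert_of_notMem hxF]
    push_cast
    ring

/-- The rank of a set is the rank of the set minus a family of its coloops, plus their number. -/
theorem eRk_eq_eRk_sdiff_add_ncard {S : Set α} (hSE : S ⊆ M.E) (K : Set α) (hKS : K ⊆ S)
    (hK : ∀ x ∈ K, x ∉ M.closure (S \ {x})) : M.eRk S = M.eRk (S \ K) + K.ncard := by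
  have hKfin : K.Finite := (M.set_finite M.E).subset (hKS.trans hSE)
  have h := eRk_sdiff_union_finset M hSE hKS hK hKfin.toFinset (by simp)
  rw [hKfin.coe_toFinset, sdiff_union_of_subset hKS] at h
  rw [h, ncard_eq_toFinset_card K hKfin]

omit [M.Finite] in
/-- An element in the closure of the rest of its set does not count for the rank. -/
theorem eRk_sdiff_singleton_eq_of_mem_closure {T : Set α} {x : α} (hxT : x ∈ T) (hx : x ∈ M.closure (T \ {x})) :
    M.eRk (T \ {x}) = M.eRk T := by
  have h1 : insert x (T \ {x}) = T := insert_sdiff_singleton.trans (insert_eq_of_mem hxT)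
  have h2 : insert x (M.closure (T \ {x})) = M.closure (T \ {x}) := insert_eq_of_mem hx
  calc M.eRk (T \ {x}) = M.eRk (M.closure (T \ {x})) := (M.eRk_closure_eq _).symm
    _ = M.eRk (insert x (M.closure (T \ {x}))) := by rw [h2]
    _ = M.eRk (insert x (T \ {x})) := M.eRk_insert_closure_eq x _
    _ = M.eRk T := by rw [h1]

/-- **The cyclic-part reduction of (INJ)**: a family `ψ C i d` of injections — from the independent `i`-sets `K` over
`cl C` (`K ⊆ E ∖ cl C`, `r(C ∪ K) = r(C) + i`) whose complement has rank `r(C ∪ ((E ∖ cl C) ∖ K)) ≥ r(C) + i + d + 1`,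
into the independent `(i + d)`-sets over `cl C` containing them — gives the lost-set injection at every tight-layer cell:
a lost set `S` with cyclic part `C` and coloops `K` goes to `C ∪ ψ C (#K) (p − #S) K`. -/
theorem lostInj_of_levelInj {p q : ℕ} (hE : M.E.ncard = p + q) (ψ : Set α → ℕ → ℕ → Set α → Set α)
    (hψ : ∀ (C : Set α) (i d : ℕ), C ⊆ M.E → 1 ≤ d →
      (∀ K, K ⊆ M.E \ M.closure C → K.ncard = i → M.eRk (C ∪ K) = M.eRk C + i →
        M.eRk C + ((i + d + 1 : ℕ) : ℕ∞) ≤ M.eRk (C ∪ ((M.E \ M.closure C) \ K)) →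
        ψ C i d K ⊆ M.E \ M.closure C ∧ (ψ C i d K).ncard = i + d ∧
          M.eRk (C ∪ ψ C i d K) = M.eRk C + ((i + d : ℕ) : ℕ∞) ∧ K ⊆ ψ C i d K) ∧
      Set.InjOn (ψ C i d) {K | K ⊆ M.E \ M.closure C ∧ K.ncard = i ∧ M.eRk (C ∪ K) = M.eRk C + i ∧
        M.eRk C + ((i + d + 1 : ℕ) : ℕ∞) ≤ M.eRk (C ∪ ((M.E \ M.closure C) \ K))}) :
    LostInj M p q := by
  classical
  have hEfin : M.E.Finite := M.set_finite M.E
  -- the data of a lost set: cyclic part `C`, coloops `K`, and the properties used by the map and by injectivity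
  have key : ∀ S ∈ lostSets M p q,
      let C := {x ∈ S | x ∈ M.closure (S \ {x})}
      let K := S \ C
      C ⊆ M.E ∧ 1 ≤ p - S.ncard ∧ K ⊆ M.E \ M.closure C ∧ M.eRk (C ∪ K) = M.eRk C + K.ncard ∧
        M.eRk C + ((K.ncard + (p - S.ncard) + 1 : ℕ) : ℕ∞) ≤ M.eRk (C ∪ ((M.E \ M.closure C) \ K)) ∧
        M.eRk C + K.ncard = (q : ℕ∞) ∧ C.ncard + K.ncard = S.ncard := by
    intro S hS
    obtain ⟨hSE, hSq, hqS, hSp, Z, hZ, hZS⟩ := hS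
    intro C K
    have hCS : C ⊆ S := fun x hx => hx.1
    have hKS : K ⊆ S := sdiff_subset
    have hCE : C ⊆ M.E := hCS.trans hSE
    have hSfin : S.Finite := hEfin.subset hSE
    have hKfin : K.Finite := hSfin.subset hKS
    have hCfin : C.Finite := hSfin.subset hCS
    have hKcl : ∀ x ∈ K, x ∉ M.closure (S \ {x}) := fun x hx h => hx.2 ⟨hx.1, h⟩
    have hSK : S \ K = C := by
      ext x
      simp only [K, mem_sdiff, not_and, not_not]
      constructor
      · rintro ⟨hxS, h⟩; exact h hxS
      · intro hxC; exact ⟨hCS hxC, fun _ => hxC⟩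
    have hrank : M.eRk S = M.eRk C + K.ncard := by
      have := eRk_eq_eRk_sdiff_add_ncard M hSE K hKS hKcl
      rwa [hSK] at this
    have hCK : C ∪ K = S := by
      rw [← hSK, sdiff_union_of_subset hKS]
    have hKE : K ⊆ M.E \ M.closure C := by
      intro x hx
      refine ⟨hSE (hKS hx), fun h => hKcl x hx (M.closure_subset_closure ?_ h)⟩
      intro y hy
      refine ⟨hCS hy, fun h' => ?_⟩
      rw [mem_singleton_iff] at h'
      exact hx.2 (h' ▸ hy)
    have hq : M.eRk C + K.ncard = (q : ℕ∞) := by rw [← hrank, hSq]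
    have hcard : C.ncard + K.ncard = S.ncard := by
      rw [← hCK, ncard_union_eq ?_ hCfin hKfin]
      exact disjoint_left.2 (fun x hxC hxK => hxK.2 hxC)
    -- the rank of `C` as a natural number
    have hCtop : M.eRk C ≠ ⊤ := ((M.eRk_le_encard C).trans_lt hCfin.encard_lt_top).ne
    obtain ⟨c, hc⟩ : ∃ c : ℕ, M.eRk C = c := ⟨(M.eRk C).toNat, (ENat.coe_toNat hCtop).symm⟩
    have hcq : c + K.ncard = q := by
      have : ((c + K.ncard : ℕ) : ℕ∞) = (q : ℕ∞) := by rw [Nat.cast_add, ← hc, hq]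
      exact_mod_cast this
    -- the member: `K ⊆ Z`
    have hZcard : Z.ncard = q := ncard_eq_q_of_mem_cellMembers_tight M hE hZ
    have hZfin : Z.Finite := hEfin.subset hZ.1
    have hZind : M.Indep Z := by
      rw [indep_iff_eRk_eq_encard_of_finite hZfin, hZ.2.1, ← hZfin.cast_ncard_eq, hZcard]
    have hZC : (Z ∩ C).ncard ≤ c := by
      have h1 : M.eRk (Z ∩ C) = ((Z ∩ C).ncard : ℕ∞) := by
        rw [(hZind.subset inter_subset_left).eRk_eq_encard, (hZfin.subset inter_subset_left).cast_ncard_eq]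
      have h2 : M.eRk (Z ∩ C) ≤ M.eRk C := M.eRk_mono inter_subset_right
      rw [h1, hc] at h2
      exact_mod_cast h2
    have hZsplit : (Z ∩ C).ncard + (Z ∩ K).ncard = Z.ncard := by
      rw [← ncard_union_eq ?_ (hZfin.subset inter_subset_left) (hZfin.subset inter_subset_left)]
      · congr 1
        ext x
        simp only [mem_union, mem_inter_iff]
        constructor
        · rintro (⟨h, -⟩ | ⟨h, -⟩) <;> exact h
        · intro hx
          have hxS := hZS hx
          rw [← hCK] at hxS
          rcases hxS with h | h
          · exact Or.inl ⟨hx, h⟩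
          · exact Or.inr ⟨hx, h⟩
      · exact disjoint_left.2 (fun x hxC hxK => hxK.2.2 hxC.2)
    have hKZ : K ⊆ Z := by
      have hsub : Z ∩ K ⊆ K := inter_subset_right
      have hle : K.ncard ≤ (Z ∩ K).ncard := by omega
      have hZK := eq_of_subset_of_ncard_le hsub hle hKfin
      intro x hx
      rw [← hZK] at hx
      exact hx.1
    -- the complement condition
    have hcompl : M.eRk C + ((K.ncard + (p - S.ncard) + 1 : ℕ) : ℕ∞) ≤ M.eRk (C ∪ ((M.E \ M.closure C) \ K)) := by
      have hsub : M.E \ Z ⊆ M.closure C ∪ ((M.E \ M.closure C) \ K) := by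
        intro x hx
        by_cases hxc : x ∈ M.closure C
        · exact Or.inl hxc
        · exact Or.inr ⟨⟨hx.1, hxc⟩, fun hxK => hx.2 (hKZ hxK)⟩
      have h1 : (p : ℕ∞) ≤ M.eRk (C ∪ ((M.E \ M.closure C) \ K)) := by
        rw [← hZ.2.2, ← M.eRk_union_closure_left_eq]
        exact M.eRk_mono hsub
      refine le_trans ?_ h1
      rw [hc, ← Nat.cast_add]
      exact_mod_cast (by omega : c + (K.ncard + (p - S.ncard) + 1) ≤ p)
    exact ⟨hCE, by omega, hKE, by rw [hCK, hrank], hcompl, hq, hcard⟩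
  -- the injection
  refine ⟨fun S => {x ∈ S | x ∈ M.closure (S \ {x})} ∪
      ψ {x ∈ S | x ∈ M.closure (S \ {x})} (S \ {x ∈ S | x ∈ M.closure (S \ {x})}).ncard (p - S.ncard)
        (S \ {x ∈ S | x ∈ M.closure (S \ {x})}), ?_, ?_⟩
  · intro S hS
    obtain ⟨hCE, hd, hKE, hCK, hcompl, hq, hcard⟩ := key S hS
    obtain ⟨hSE, hSq, hqS, hSp, -⟩ := hS
    dsimp only
    set C := {x ∈ S | x ∈ M.closure (S \ {x})} with hCdef
    set K := S \ C with hKdef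
    obtain ⟨hψE, hψcard, hψrk, hKψ⟩ := (hψ C K.ncard (p - S.ncard) hCE hd).1 K hKE rfl hCK hcompl
    have hCS : C ⊆ S := fun x hx => hx.1
    have hCKS : C ∪ K = S := by rw [hKdef, union_sdiff_cancel hCS]
    have hdisj : Disjoint C (ψ C K.ncard (p - S.ncard) K) :=
      disjoint_left.2 (fun x hxC hxψ => (hψE hxψ).2 (M.subset_closure C hCE hxC))
    have hCfin : C.Finite := hEfin.subset hCE
    have hψfin : (ψ C K.ncard (p - S.ncard) K).Finite := hEfin.subset (hψE.trans sdiff_subset)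
    have hCtop : M.eRk C ≠ ⊤ := ((M.eRk_le_encard C).trans_lt hCfin.encard_lt_top).ne
    obtain ⟨c, hc⟩ : ∃ c : ℕ, M.eRk C = c := ⟨(M.eRk C).toNat, (ENat.coe_toNat hCtop).symm⟩
    have hcq : c + K.ncard = q := by
      have : ((c + K.ncard : ℕ) : ℕ∞) = (q : ℕ∞) := by rw [Nat.cast_add, ← hc, hq]
      exact_mod_cast this
    refine ⟨⟨⟨union_subset hCE (hψE.trans sdiff_subset), ?_, ?_⟩, ?_⟩, ?_⟩
    · -- `q < r(T)`
      rw [hψrk, hc, ← Nat.cast_add]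
      exact_mod_cast (by omega : q < c + (K.ncard + (p - S.ncard)))
    · -- `r(T) < p`
      rw [hψrk, hc, ← Nat.cast_add]
      exact_mod_cast (by omega : c + (K.ncard + (p - S.ncard)) < p)
    · -- `#T ≥ p`
      rw [ncard_union_eq hdisj hCfin hψfin, hψcard]
      omega
    · -- `S ⊆ T`
      intro x hx
      rw [← hCKS] at hx
      rcases hx with h | h
      · exact Or.inl h
      · exact Or.inr (hKψ h)
  · intro S₁ hS₁ S₂ hS₂ heq
    simp only at heq
    obtain ⟨hCE₁, hd₁, hKE₁, hCK₁, hcompl₁, hq₁, hcard₁⟩ := key S₁ hS₁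
    obtain ⟨hCE₂, hd₂, hKE₂, hCK₂, hcompl₂, hq₂, hcard₂⟩ := key S₂ hS₂
    set C₁ := {x ∈ S₁ | x ∈ M.closure (S₁ \ {x})} with hC₁
    set K₁ := S₁ \ C₁ with hK₁
    set C₂ := {x ∈ S₂ | x ∈ M.closure (S₂ \ {x})} with hC₂
    set K₂ := S₂ \ C₂ with hK₂
    obtain ⟨hψE₁, hψcard₁, hψrk₁, hKψ₁⟩ := (hψ C₁ K₁.ncard (p - S₁.ncard) hCE₁ hd₁).1 K₁ hKE₁ rfl hCK₁ hcompl₁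
    obtain ⟨hψE₂, hψcard₂, hψrk₂, hKψ₂⟩ := (hψ C₂ K₂.ncard (p - S₂.ncard) hCE₂ hd₂).1 K₂ hKE₂ rfl hCK₂ hcompl₂
    set T := C₁ ∪ ψ C₁ K₁.ncard (p - S₁.ncard) K₁ with hT
    have hT₂ : T = C₂ ∪ ψ C₂ K₂.ncard (p - S₂.ncard) K₂ := heq
    -- the cyclic part of the target is the cyclic part of the source
    have cyc : ∀ (S : Set α), S ∈ lostSets M p q →
        let C := {x ∈ S | x ∈ M.closure (S \ {x})}
        let K := S \ C
        ∀ ψK : Set α, ψK ⊆ M.E \ M.closure C → ψK.ncard = K.ncard + (p - S.ncard) →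
          M.eRk (C ∪ ψK) = M.eRk C + ((K.ncard + (p - S.ncard) : ℕ) : ℕ∞) → K ⊆ ψK →
          {x ∈ C ∪ ψK | x ∈ M.closure ((C ∪ ψK) \ {x})} = C := by
      intro S hS C K ψK hψKE hψKcard hψKrk hKψK
      obtain ⟨hSE, -, -, -, -⟩ := hS
      have hCS : C ⊆ S := fun x hx => hx.1
      have hCE : C ⊆ M.E := hCS.trans hSE
      have hCfin : C.Finite := hEfin.subset hCE
      have hψfin : ψK.Finite := hEfin.subset (hψKE.trans sdiff_subset)
      have hCKS : C ∪ K = S := by rw [union_sdiff_cancel hCS]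
      ext x
      simp only [mem_setOf_eq]
      constructor
      · rintro ⟨hxT, hxcl⟩
        rcases hxT with hxC | hxψ
        · exact hxC
        · exfalso
          -- `x ∈ ψK` is a coloop of `C ∪ ψK`: removing it drops the rank
          have hxE : x ∈ M.E := (hψKE hxψ).1
          have h1 : M.eRk ((C ∪ ψK) \ {x}) = M.eRk (C ∪ ψK) :=
            eRk_sdiff_singleton_eq_of_mem_closure M (Or.inr hxψ) hxcl
          have h2 : (C ∪ ψK) \ {x} = C ∪ (ψK \ {x}) := by
            rw [union_sdiff_distrib]
            congr 1
            rw [sdiff_eq_left]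
            exact disjoint_singleton_right.2 (fun h => (hψKE hxψ).2 (M.subset_closure C hCE h))
          have h3 : M.eRk (C ∪ (ψK \ {x})) ≤ M.eRk C + (ψK \ {x}).encard := M.eRk_union_le_eRk_add_encard C _
          have h4 : (ψK \ {x}).encard = ((K.ncard + (p - S.ncard) - 1 : ℕ) : ℕ∞) := by
            rw [← (hψfin.subset sdiff_subset).cast_ncard_eq, ncard_sdiff_singleton_of_mem hxψ, hψKcard]
          rw [h4] at h3
          rw [← h2, h1, hψKrk] at h3
          -- `r(C) + (m) ≤ r(C) + (m − 1)` with `m ≥ 1`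
          have hCtop : M.eRk C ≠ ⊤ := ((M.eRk_le_encard C).trans_lt hCfin.encard_lt_top).ne
          obtain ⟨c, hc⟩ : ∃ c : ℕ, M.eRk C = c := ⟨(M.eRk C).toNat, (ENat.coe_toNat hCtop).symm⟩
          rw [hc, ← Nat.cast_add, ← Nat.cast_add] at h3
          have h5 : c + (K.ncard + (p - S.ncard)) ≤ c + (K.ncard + (p - S.ncard) - 1) := by exact_mod_cast h3
          have hm : 1 ≤ K.ncard + (p - S.ncard) := by
            have : 0 < ψK.ncard := ncard_pos hψfin |>.2 ⟨x, hxψ⟩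
            omega
          omega
      · intro hxC
        refine ⟨Or.inl hxC, ?_⟩
        refine M.closure_subset_closure ?_ hxC.2
        intro y hy
        refine ⟨?_, hy.2⟩
        have : y ∈ C ∪ K := by rw [hCKS]; exact hy.1
        rcases this with h | h
        · exact Or.inl h
        · exact Or.inr (hKψK h)
    have hcyc₁ : {x ∈ T | x ∈ M.closure (T \ {x})} = C₁ := cyc S₁ hS₁ _ hψE₁ hψcard₁ hψrk₁ hKψ₁
    have hcyc₂ : {x ∈ T | x ∈ M.closure (T \ {x})} = C₂ := by
      rw [hT₂]
      exact cyc S₂ hS₂ _ hψE₂ hψcard₂ hψrk₂ hKψ₂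
    have hC : C₁ = C₂ := hcyc₁.symm.trans hcyc₂
    -- the sizes of the coloop parts agree: `r(C) + #K = q`
    have hCtop : M.eRk C₁ ≠ ⊤ := ((M.eRk_le_encard C₁).trans_lt (hEfin.subset hCE₁).encard_lt_top).ne
    have hi : K₁.ncard = K₂.ncard := by
      have h := hq₁.trans hq₂.symm
      rw [← hC] at h
      have h' := WithTop.add_left_cancel hCtop h
      exact Nat.cast_injective h'
    have hd : p - S₁.ncard = p - S₂.ncard := by
      have h1 := hcard₁; have h2 := hcard₂
      rw [hC] at h1
      omega
    -- the `ψ`-parts agree: both equal `T ∖ C`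
    have hψeq : ψ C₁ K₁.ncard (p - S₁.ncard) K₁ = ψ C₂ K₂.ncard (p - S₂.ncard) K₂ := by
      have e1 : ψ C₁ K₁.ncard (p - S₁.ncard) K₁ = T \ C₁ := by
        rw [hT, union_sdiff_left]
        exact (sdiff_eq_left.2 (disjoint_left.2 (fun x hx hxC => (hψE₁ hx).2 (M.subset_closure C₁ hCE₁ hxC)))).symm
      have e2 : ψ C₂ K₂.ncard (p - S₂.ncard) K₂ = T \ C₂ := by
        rw [hT₂, union_sdiff_left]
        exact (sdiff_eq_left.2 (disjoint_left.2 (fun x hx hxC => (hψE₂ hx).2 (M.subset_closure C₂ hCE₂ hxC)))).symm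
      rw [e1, e2, hC]
    rw [hC, hi, hd] at hψeq
    have hK : K₁ = K₂ := by
      refine (hψ C₂ K₂.ncard (p - S₂.ncard) hCE₂ hd₂).2 ?_ ⟨hKE₂, rfl, hCK₂, hcompl₂⟩ hψeq
      rw [← hC]
      refine ⟨hKE₁, hi, ?_, ?_⟩
      · rw [hCK₁, hi]
      · rw [← hi, ← hd]; exact hcompl₁
    -- `S = C ∪ K`
    have hS₁' : S₁ = C₁ ∪ K₁ := (union_sdiff_cancel (fun x hx => hx.1 : C₁ ⊆ S₁)).symm
    have hS₂' : S₂ = C₂ ∪ K₂ := (union_sdiff_cancel (fun x hx => hx.1 : C₂ ⊆ S₂)).symm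
    rw [hS₁', hS₂', hC, hK]

end PercRepro
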